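import Literature.Computability.AlgebraicComplexity.BI17DegreeExponentMonoidProofs
import Literature.Computability.AlgebraicComplexity.BI17ChowMonomialStabilizerProofs
import Literature.Computability.AlgebraicComplexity.BI17ChowPowerSumPolystableProofs
import Literature.Computability.AlgebraicComplexity.BI17DetPerMinimalDegreeProofs
import Literature.Computability.AlgebraicComplexity.StandardFamiliesProofs
import HarnessLib

/-!
# Non-normal orbit closures: `X_1⋯X_m` (`m > 2`), `det_n`, `per_n` (`n > 2`) — Bürgisser–Ikenmeyer 2017,
# Cor. 3.29: discharge of `BI2017_cor_3_29`

P. Bürgisser, C. Ikenmeyer, *Fundamental invariants of orbit closures*, J. Algebra **477** (2017)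
390–434 = arXiv:1511.02927 [BurgisserIkenmeyer2017], §3.3 Cor. 3.29 (`\label{cor:not-normal}`,
main.tex L1538, held text `paper:arxiv-1511.02927` p0014:L28): "1. The orbit closure of `X_1⋯X_m` is
not normal if `m > 2`. 2. The orbit closures of `det_n` and `per_n` are not normal if `n > 2`."
Printed proof: "The stabilizer period of these forms is at most `2` by Proposition 2.4(1),
Theorem 2.5, and Theorem 2.6. Now apply Corollary 3.17" (L1546–1548).

Theorem-only companion of the file of record `BI17FundamentalInvariantForms.lean` (cell `val-lit`, row
BI17-A), which types the corollary as the named fact `BI2017_cor_3_29`; here it is DISCHARGED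
(`BI2017_cor_3_29_holds`) exactly along the printed line. Part (1) (`BI2017_cor_3_29_1`): the
stabilizer period of `X_1⋯X_m` is `2` (Prop. 2.4 (1), the tree's `BI2017_prop_2_4_1_holds`),
`X_1⋯X_m` is polystable (Cor. 2.9, the tree's `isPolystable_prod_X`), so for `m > 2` we have
`a(w) = 2 < m = D` and Cor. 3.17 (1) (the tree's `BI2017_cor_3_17_1`,
`BI17DegreeExponentMonoidProofs.lean`) applies. Part (2) (`BI2017_cor_3_29_2_det`,
`BI2017_cor_3_29_2_per`; `det_n`, `per_n` live over the variable type `Fin n × Fin n`): the same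
argument after renaming the variables along `finProdFinEquiv : Fin n × Fin n ≃ Fin n²` — normality of
the orbit closure, polystability and the stabilizer period are invariant under renaming (t04's
transport API `isIntegrallyClosed_orbitCoordRing_rename_iff`, `IsPolystable.rename_equiv`,
`stabilizerPeriod_rename_equiv`, `BI17DetPerMinimalDegreeProofs.lean`), `det_n`, `per_n` are
polystable (Cor. 2.9, `BurgisserIkenmeyer2017_polystable_det_per_holds`) with stabilizer period `≤ 2`
(Thm. 2.5 / 2.6, `BI2017_thm_2_5_period_holds`, `BI2017_thm_2_6_period_holds`) `< n`.

Also: Cor. 3.17 (2) for generic forms CONDITIONALLY on generic polystability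
(`BI2017_cor_3_17_2_of_prop_2_10`, `BI2017_cor_3_17_of_prop_2_10 : BI2017_prop_2_10 → BI2017_cor_3_17`;
`b(w) = m/gcd(D,m)` from `a'(w) = 1`, Lemma 2.1 and eq. (3.1), then Thm. 3.15 and Thm. 3.10), with a
small `IsZariskiGeneric` API (`and`, `mono`, `isZariskiGeneric_ne_zero`).

No definitions, no named facts; nothing here bears on VP versus VNP.

## References

* [BurgisserIkenmeyer2017] P. Bürgisser, C. Ikenmeyer, *Fundamental invariants of orbit closures*,
  J. Algebra 477 (2017) 390–434; arXiv:1511.02927, §3.3 Cor. 3.29 with Prop. 2.4 (1), Cor. 2.9,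
  Cor. 3.17 (1). [cite: BurgisserIkenmeyer2017, Cor. 3.29]

## Tree

`BI2017_cor_3_17_1` (`BI17DegreeExponentMonoidProofs`), `BI2017_prop_2_4_1_holds`
(`BI17ChowMonomialStabilizerProofs`), `isPolystable_prod_X` (`BI17ChowPowerSumPolystableProofs`),
`isIntegrallyClosed_orbitCoordRing_rename_iff`, `IsPolystable.rename_equiv`,
`stabilizerPeriod_rename_equiv` (`BI17DetPerMinimalDegreeProofs`),
`BurgisserIkenmeyer2017_polystable_det_per_holds` (`PolystabilityProofs`), `BI2017_thm_2_5_period_holds`,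
`BI2017_thm_2_6_period_holds`, `detPoly_isHomogeneous`, `perPoly_isHomogeneous` (`StandardFamilies`),
`perPoly_ne_zero` (`StandardFamiliesProofs`), Mathlib `Matrix.det_mvPolynomialX_ne_zero`. Standard axioms only.
-/

noncomputable section

open MvPolynomial

namespace Literature.Computability.AlgebraicComplexity

/-- `X_1⋯X_m` is a form of degree `m`. [cite: BurgisserIkenmeyer2017, Prop. 2.4 (1)] -/
theorem isHomogeneous_prod_X_fin (m : ℕ) :
    (∏ i : Fin m, X i : MvPolynomial (Fin m) ℂ).IsHomogeneous m := by
  have h := IsHomogeneous.prod (Finset.univ : Finset (Fin m)) (fun i => (X i : MvPolynomial (Fin m) ℂ))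
    (fun _ => 1) fun i _ => isHomogeneous_X ℂ i
  rwa [Finset.sum_const, Finset.card_univ, Fintype.card_fin, smul_eq_mul, mul_one] at h

/-- `X_1⋯X_m ≠ 0`. [cite: BurgisserIkenmeyer2017, Prop. 2.4 (1)] -/
theorem prod_X_fin_ne_zero (m : ℕ) : (∏ i : Fin m, X i : MvPolynomial (Fin m) ℂ) ≠ 0 :=
  Finset.prod_ne_zero_iff.2 fun i _ => X_ne_zero i

/-- **BI 2017, Cor. 3.29 (1)** (L1538–1548, p0014:L28): "The orbit closure of `X_1⋯X_m` is not normal if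
`m > 2`" — its coordinate ring `ℂ[Sym^m ℂ^m] ⧸ I(GL_m · X_1⋯X_m)` is not integrally closed. Printed
proof: `a(X_1⋯X_m) = 2` (Prop. 2.4 (1)) `< m`, `X_1⋯X_m` polystable (Cor. 2.9), Cor. 3.17 (1).
[cite: BurgisserIkenmeyer2017, Cor. 3.29 (1)] -/
theorem BI2017_cor_3_29_1 {m : ℕ} (hm : 2 < m) :
    ¬ IsIntegrallyClosed (OrbitCoordRing (∏ i : Fin m, X i : MvPolynomial (Fin m) ℂ) m) := by
  have ha : stabilizerPeriod (∏ i : Fin m, X i : MvPolynomial (Fin m) ℂ) = 2 :=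
    (BI2017_prop_2_4_1_holds m).2 (by omega)
  exact BI2017_cor_3_17_1 (by omega) (isHomogeneous_prod_X_fin m) (prod_X_fin_ne_zero m)
    (isPolystable_prod_X m) (by rw [ha]; exact hm)

/-- **BI 2017, Cor. 3.29 (2), `det_n`** (L1538–1548): the orbit closure of `det_n` is not normal for
`n > 2` — `a(det_n) ≤ 2 < n` (Thm. 2.5), `det_n` polystable (Cor. 2.9), Cor. 3.17 (1), after renaming
the `n²` variables along `Fin n × Fin n ≃ Fin n²`. [cite: BurgisserIkenmeyer2017, Cor. 3.29 (2)] -/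
theorem BI2017_cor_3_29_2_det {n : ℕ} (hn : 2 < n) :
    ¬ IsIntegrallyClosed (OrbitCoordRing (detPoly (Fin n) ℂ) n) := by
  rw [← isIntegrallyClosed_orbitCoordRing_rename_iff finProdFinEquiv n (detPoly (Fin n) ℂ)]
  have hhom : (rename finProdFinEquiv (detPoly (Fin n) ℂ) : MvPolynomial (Fin (n * n)) ℂ).IsHomogeneous n := by
    have h := (detPoly_isHomogeneous (n := Fin n) (k := ℂ)).rename_isHomogeneous
      (f := (finProdFinEquiv : Fin n × Fin n ≃ Fin (n * n)))
    rwa [Fintype.card_fin] at h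
  have hne : (rename finProdFinEquiv (detPoly (Fin n) ℂ) : MvPolynomial (Fin (n * n)) ℂ) ≠ 0 :=
    fun h => Matrix.det_mvPolynomialX_ne_zero (Fin n) ℂ
      (rename_injective _ finProdFinEquiv.injective (by rw [map_zero]; exact h))
  have hpoly : IsPolystable (rename finProdFinEquiv (detPoly (Fin n) ℂ) : MvPolynomial (Fin (n * n)) ℂ) :=
    (BurgisserIkenmeyer2017_polystable_det_per_holds n).1.rename_equiv finProdFinEquiv
  have ha : stabilizerPeriod (rename finProdFinEquiv (detPoly (Fin n) ℂ) : MvPolynomial (Fin (n * n)) ℂ) < n := by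
    rw [stabilizerPeriod_rename_equiv, BI2017_thm_2_5_period_holds n]
    split_ifs <;> omega
  exact BI2017_cor_3_17_1 (by omega) hhom hne hpoly ha

/-- **BI 2017, Cor. 3.29 (2), `per_n`** (L1538–1548): the orbit closure of `per_n` is not normal for
`n > 2` — `a(per_n) ≤ 2 < n` (Thm. 2.6), `per_n` polystable (Cor. 2.9), Cor. 3.17 (1), after renaming
the variables along `Fin n × Fin n ≃ Fin n²`. [cite: BurgisserIkenmeyer2017, Cor. 3.29 (2)] -/
theorem BI2017_cor_3_29_2_per {n : ℕ} (hn : 2 < n) :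
    ¬ IsIntegrallyClosed (OrbitCoordRing (perPoly (Fin n) ℂ) n) := by
  rw [← isIntegrallyClosed_orbitCoordRing_rename_iff finProdFinEquiv n (perPoly (Fin n) ℂ)]
  have hhom : (rename finProdFinEquiv (perPoly (Fin n) ℂ) : MvPolynomial (Fin (n * n)) ℂ).IsHomogeneous n := by
    have h := (perPoly_isHomogeneous (n := Fin n) (k := ℂ)).rename_isHomogeneous
      (f := (finProdFinEquiv : Fin n × Fin n ≃ Fin (n * n)))
    rwa [Fintype.card_fin] at h
  have hne : (rename finProdFinEquiv (perPoly (Fin n) ℂ) : MvPolynomial (Fin (n * n)) ℂ) ≠ 0 :=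
    fun h => perPoly_ne_zero (Fin n) ℂ
      (rename_injective _ finProdFinEquiv.injective (by rw [map_zero]; exact h))
  have hpoly : IsPolystable (rename finProdFinEquiv (perPoly (Fin n) ℂ) : MvPolynomial (Fin (n * n)) ℂ) :=
    (BurgisserIkenmeyer2017_polystable_det_per_holds n).2.rename_equiv finProdFinEquiv
  have ha : stabilizerPeriod (rename finProdFinEquiv (perPoly (Fin n) ℂ) : MvPolynomial (Fin (n * n)) ℂ) < n := by
    rw [stabilizerPeriod_rename_equiv, BI2017_thm_2_6_period_holds n hn]
    split_ifs <;> omega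
  exact BI2017_cor_3_17_1 (by omega) hhom hne hpoly ha

/-- **BI 2017, Cor. 3.29 — DISCHARGED** (`\label{cor:not-normal}`, L1538, p0014:L28): "1. The orbit closure
of `X_1⋯X_m` is not normal if `m > 2`. 2. The orbit closures of `det_n` and `per_n` are not normal if
`n > 2`." [cite: BurgisserIkenmeyer2017, Cor. 3.29] -/
theorem BI2017_cor_3_29_holds : BI2017_cor_3_29 :=
  ⟨fun _ hm => BI2017_cor_3_29_1 hm, fun _ hn => ⟨BI2017_cor_3_29_2_det hn, BI2017_cor_3_29_2_per hn⟩⟩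

/-! ### Cor. 3.17 (2) for generic forms, conditionally on generic polystability (Prop. 2.10) -/

section GenericNonNormal

variable {m D : ℕ}

/-- Zariski-generic properties are closed under conjunction (product of the test polynomials).
[cite: BurgisserIkenmeyer2017, §2.1 ("almost all")] -/
theorem IsZariskiGeneric.and {P Q : MvPolynomial (Fin m) ℂ → Prop} (hP : IsZariskiGeneric D P)
    (hQ : IsZariskiGeneric D Q) : IsZariskiGeneric D fun f => P f ∧ Q f := by
  obtain ⟨F, hF0, hF⟩ := hP
  obtain ⟨G, hG0, hG⟩ := hQ
  refine ⟨F * G, mul_ne_zero hF0 hG0, fun f hf hFG => ?_⟩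
  rw [map_mul] at hFG
  exact ⟨hF f hf (left_ne_zero_of_mul hFG), hG f hf (right_ne_zero_of_mul hFG)⟩

/-- A Zariski-generic property implies any weaker property of forms generically.
[cite: BurgisserIkenmeyer2017, §2.1 ("almost all")] -/
theorem IsZariskiGeneric.mono {P Q : MvPolynomial (Fin m) ℂ → Prop} (hP : IsZariskiGeneric D P)
    (hPQ : ∀ f : MvPolynomial (Fin m) ℂ, f.IsHomogeneous D → P f → Q f) : IsZariskiGeneric D Q := by
  obtain ⟨F, hF0, hF⟩ := hP
  exact ⟨F, hF0, fun f hf hFf => hPQ f hf (hF f hf hFf)⟩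

/-- Generic forms are nonzero (`m ≥ 1`; test polynomial: the coordinate of `X_0^D`).
[cite: BurgisserIkenmeyer2017, §2.1 ("almost all")] -/
theorem isZariskiGeneric_ne_zero (hm : 0 < m) (D : ℕ) :
    IsZariskiGeneric D fun f : MvPolynomial (Fin m) ℂ => f ≠ 0 := by
  have hd : Finsupp.single (⟨0, hm⟩ : Fin m) D ∈ degMonomials (Fin m) D := by
    rw [mem_degMonomials_iff, Finsupp.degree_single]
  refine ⟨X ⟨_, hd⟩, X_ne_zero _, fun f _ hF => ?_⟩
  rintro rfl
  rw [aeval_X, formCoeff_apply, coeff_zero] at hF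
  exact hF rfl

/-- **`b(w) = m / gcd(D,m)` when `a'(w) = 1`** (BI Def. 3.1: "`b(w) = a'(w) m / gcd(D,m)`", L719;
from Lemma 2.1 `D/gcd(D,m) ∣ a(w)` and eq. (3.1) `D b(w) = m a(w)`).
[cite: BurgisserIkenmeyer2017, Def. 3.1] -/
theorem degreePeriod_eq_div_gcd_of_reducedStabilizerPeriod_eq_one {f : MvPolynomial (Fin m) ℂ}
    (hD : 0 < D) (hf : f.IsHomogeneous D) (ha' : reducedStabilizerPeriod D f = 1) :
    degreePeriod D f = m / Nat.gcd D m := by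
  set g := Nat.gcd D m with hg
  have hg0 : 0 < g := Nat.gcd_pos_of_pos_left _ hD
  have hgD : g ∣ D := Nat.gcd_dvd_left D m
  have hgm : g ∣ m := Nat.gcd_dvd_right D m
  obtain ⟨c, hc⟩ := BI2017_lem_2_1 hf hD
  -- `a(w) g = D c`, so `a'(w) = c = 1` and `a(w) = D / g`
  have hag : stabilizerPeriod f * g = D * c := by
    rw [hc, mul_comm (D / g) c, mul_assoc, Nat.div_mul_cancel hgD, mul_comm]
  have hc1 : c = 1 := by
    rw [reducedStabilizerPeriod, Fintype.card_fin, ← hg, hag, Nat.mul_div_cancel_left _ hD] at ha'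
    exact ha'
  rw [hc1, mul_one] at hc
  -- `D b = m a = m (D/g) = D (m/g)`
  have h31 := BI2017_eq_3_1 hf hD
  rw [hc] at h31
  have hm' : m * (D / g) = D * (m / g) := by
    conv_lhs => rw [← Nat.div_mul_cancel hgm]
    rw [mul_assoc, mul_comm g, Nat.div_mul_cancel hgD, mul_comm]
  rw [hm'] at h31
  exact Nat.eq_of_mul_eq_mul_left hD h31

/-- **BI 2017, Cor. 3.17 (2), conditionally on Prop. 2.10** (L1170–1178, p0011:L13): for `D, m ≥ 2`, if
almost all `w ∈ Sym^D ℂ^m` are polystable (Prop. 2.10, the open fact `BI2017_prop_2_10`) and have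
`a'(w) = 1`, and `D` is odd or `gcd(D,m) > 1`, then almost all `w` have a non-normal orbit closure:
`b(w) = m/gcd(D,m)` is `< e(w)` by Thm. 3.15 (`e(w) ≥ m`, `> m` for odd `D`), so Thm. 3.10 applies.
(The printed proof reads `e(w) = e(D,m)` off Cor. 3.16; Thm. 3.15 at the generic `w` itself suffices.)
[cite: BurgisserIkenmeyer2017, Cor. 3.17 (2)] -/
theorem BI2017_cor_3_17_2_of_prop_2_10 (h210 : BI2017_prop_2_10) (hD : 2 ≤ D) (hm : 2 ≤ m)
    (hgen : IsZariskiGeneric D (fun f : MvPolynomial (Fin m) ℂ => reducedStabilizerPeriod D f = 1))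
    (hcase : Odd D ∨ 1 < Nat.gcd D m) :
    IsZariskiGeneric D fun f : MvPolynomial (Fin m) ℂ => ¬ IsIntegrallyClosed (OrbitCoordRing f D) := by
  have hD0 : 0 < D := by omega
  refine ((hgen.and (h210 D m (by omega))).and (isZariskiGeneric_ne_zero (by omega) D)).mono ?_
  rintro f hf ⟨⟨ha', hpoly⟩, hf0⟩
  refine not_isIntegrallyClosed_orbitCoordRing hD hf hf0 hpoly ?_
  obtain ⟨hle, hodd, -, -⟩ := BI2017_thm_3_15_holds m D f hm hD hf hf0 hpoly
  rw [degreePeriod_eq_div_gcd_of_reducedStabilizerPeriod_eq_one hD0 hf ha']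
  rcases hcase with hD1 | hg
  · exact (Nat.div_le_self m _).trans_lt (hodd hD1)
  · exact (Nat.div_lt_self (by omega) hg).trans_le hle

/-- **BI 2017, Cor. 3.17 ⇐ Prop. 2.10**: part (1) is the tree's `BI2017_cor_3_17_1`, part (2) is
`BI2017_cor_3_17_2_of_prop_2_10`; the named fact `BI2017_cor_3_17` thus depends only on generic
polystability (`BI2017_prop_2_10`, Luna 1973 / Thm. 2.3). [cite: BurgisserIkenmeyer2017, Cor. 3.17] -/
theorem BI2017_cor_3_17_of_prop_2_10 (h210 : BI2017_prop_2_10) : BI2017_cor_3_17 :=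
  ⟨fun _ _ _ hD hf hf0 hpoly _ haD => BI2017_cor_3_17_1 hD hf hf0 hpoly haD,
    fun _ _ hD hm hgen hcase => BI2017_cor_3_17_2_of_prop_2_10 h210 hD hm hgen hcase⟩

/-- **BI 2017, Cor. 3.17 (2), one degree at a time**: the per-`(D, m)` form of
`BI2017_cor_3_17_2_of_prop_2_10` — if almost all `w ∈ Sym^D ℂ^m` are polystable (the `(D, m)`
instance of Prop. 2.10, e.g. the tree's `BI2017_prop_2_10_two` at `D = 2`, or any future slice) and
almost all have `a'(w) = 1`, and `D` is odd or `gcd(D,m) > 1` (`D, m ≥ 2`), then almost all `w` have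
a non-normal orbit closure. Same proof, with the whole fact `BI2017_prop_2_10` replaced by its
`(D, m)` instance. [cite: BurgisserIkenmeyer2017, Cor. 3.17 (2)] -/
theorem BI2017_cor_3_17_2_of_isZariskiGeneric_isPolystable (hD : 2 ≤ D) (hm : 2 ≤ m)
    (hpoly : IsZariskiGeneric D (IsPolystable : MvPolynomial (Fin m) ℂ → Prop))
    (hgen : IsZariskiGeneric D (fun f : MvPolynomial (Fin m) ℂ => reducedStabilizerPeriod D f = 1))
    (hcase : Odd D ∨ 1 < Nat.gcd D m) :
    IsZariskiGeneric D fun f : MvPolynomial (Fin m) ℂ => ¬ IsIntegrallyClosed (OrbitCoordRing f D) := by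
  have hD0 : 0 < D := by omega
  refine ((hgen.and hpoly).and (isZariskiGeneric_ne_zero (by omega) D)).mono ?_
  rintro f hf ⟨⟨ha', hpf⟩, hf0⟩
  refine not_isIntegrallyClosed_orbitCoordRing hD hf hf0 hpf ?_
  obtain ⟨hle, hodd, -, -⟩ := BI2017_thm_3_15_holds m D f hm hD hf hf0 hpf
  rw [degreePeriod_eq_div_gcd_of_reducedStabilizerPeriod_eq_one hD0 hf ha']
  rcases hcase with hD1 | hg
  · exact (Nat.div_le_self m _).trans_lt (hodd hD1)
  · exact (Nat.div_lt_self (by omega) hg).trans_le hle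

/-- The fact-level reduction is the per-degree one applied to every instance of Prop. 2.10
(consistency check of the two statements). [cite: BurgisserIkenmeyer2017, Cor. 3.17 (2)] -/
theorem BI2017_cor_3_17_2_of_prop_2_10' (h210 : BI2017_prop_2_10) (hD : 2 ≤ D) (hm : 2 ≤ m)
    (hgen : IsZariskiGeneric D (fun f : MvPolynomial (Fin m) ℂ => reducedStabilizerPeriod D f = 1))
    (hcase : Odd D ∨ 1 < Nat.gcd D m) :
    IsZariskiGeneric D fun f : MvPolynomial (Fin m) ℂ => ¬ IsIntegrallyClosed (OrbitCoordRing f D) :=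
  BI2017_cor_3_17_2_of_isZariskiGeneric_isPolystable hD hm (h210 D m (by omega)) hgen hcase

end GenericNonNormal

end Literature.Computability.AlgebraicComplexity

end
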